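import Mathlib
import Summits.MatrixMultiplication.MatrixMultiplication.Theorems.LieRankDesigns.Negative.Basics

/-!
# Crux `LieRankDesigns` (stmt-MatrixMultiplication-7614), line `Sketch`: level-`k` frame-token count no. 1

Lead seat prover-line-stmt-MatrixMultiplication-7614-c4-0.  Registered stub `stub_card_targets_frame_le`
(= level-`k` frame-token count no. 1), generalising `card_targets_token_le` of
`Theorems/LieRankDesigns/Negative/PrivateTokenCounts.lean` from vectors (`k = 1`) to `m × k` frames.

A FREE-FRAME witness `v` assigns to each target `(x₀, z₀) ∈ X × Z` a frame `v x₀ z₀ ∈ M_{m×k}(𝔽_p)` on which a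
based quadruple product `x⁻¹ y y'⁻¹ z` agrees with the target `x₀⁻¹ z₀` only trivially (hypothesis `hPT`).
FRAME INJECTIVITY: for a fixed frame `U`, the targets `(x₀, z₀)` with `v x₀ z₀ = U` are mapped injectively into
`M_{m×k}(𝔽_p)` (of cardinality `p^{mk}`) by `(x₀, z₀) ↦ x₀⁻¹ z₀ U` — a coincidence `x₀⁻¹ z₀ U = x₁⁻¹ z₁ U` is the
violating quadruple `(x₁, y, y, z₁)` (any `y ∈ Y`, so `Y ≠ ∅` is needed) of the target `(x₀, z₀)`.  Hence
`#{(x₀, z₀) ∈ X × Z : v x₀ z₀ = U} ≤ p^{mk}` (the frame count `|M_{m×k}(𝔽_p)| = p^{mk}` is computed inline).  No theorem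
here asserts a Theses statement positively.
-/

set_option linter.dupNamespace false

noncomputable section

open scoped BigOperators

namespace Summit.MatrixMultiplication.MatrixMultiplication.Theorems.LieRankDesigns

open Summit.MatrixMultiplication.MatrixMultiplication.Theorems.LieRankDesigns.Negative
  (GLm Mat fourierFn RankSupp RankSep levelSet budget volume)

/-- **Frame injectivity** (level-`k` frame-token count no. 1, registered stub of the crux `LieRankDesigns`,
line `Sketch`).  For a free-frame witness `v : X × Z → M_{m×k}(𝔽_p)` and any frame `U`, the targets `(x₀, z₀)`
with `v x₀ z₀ = U` number at most `p^{mk}`: they are mapped injectively to `x₀⁻¹ z₀ U ∈ M_{m×k}(𝔽_p)`, two of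
them colliding being the violating quadruple `(x₁, y, y, z₁)` of the target `(x₀, z₀)` (needs `Y ≠ ∅`).
Generalises `Negative.card_targets_token_le` (`k = 1`, column vectors) verbatim. -/
theorem stub_card_targets_frame_le :
    ∀ (p m k : ℕ) [Fact p.Prime] (X Y Z : Finset (GLm p m))
      (v : GLm p m → GLm p m → Matrix (Fin m) (Fin k) (ZMod p)),
      (∀ x₀ ∈ X, ∀ z₀ ∈ Z, ∀ x ∈ X, ∀ y ∈ Y, ∀ y' ∈ Y, ∀ z ∈ Z,
        ((x⁻¹ * y * y'⁻¹ * z : GLm p m) : Mat p m) * v x₀ z₀ = ((x₀⁻¹ * z₀ : GLm p m) : Mat p m) * v x₀ z₀ →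
          x = x₀ ∧ y = y' ∧ z = z₀) →
      Y.Nonempty → ∀ U : Matrix (Fin m) (Fin k) (ZMod p),
        ((X ×ˢ Z).filter fun t => v t.1 t.2 = U).card ≤ p ^ (m * k) := by
  intro p m k _ X Y Z v hPT hY U
  obtain ⟨y, hy⟩ := hY
  -- `|M_{m×k}(𝔽_p)| = p^{mk}`
  have hcard : (Finset.univ : Finset (Matrix (Fin m) (Fin k) (ZMod p))).card = p ^ (m * k) := by
    rw [Finset.card_univ]
    change Fintype.card (Fin m → Fin k → ZMod p) = _
    rw [Fintype.card_fun, Fintype.card_fun, ZMod.card, Fintype.card_fin, Fintype.card_fin, ← pow_mul, mul_comm]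
  rw [← hcard]
  refine Finset.card_le_card_of_injOn (fun t => ((t.1⁻¹ * t.2 : GLm p m) : Mat p m) * U)
    (fun t _ => Finset.mem_univ _) ?_
  rintro ⟨x₀, z₀⟩ h₀ ⟨x₁, z₁⟩ h₁ heq
  simp only [Finset.coe_filter, Finset.mem_product, Set.mem_setOf_eq] at h₀ h₁
  obtain ⟨⟨hx₀, hz₀⟩, hv₀⟩ := h₀
  obtain ⟨⟨hx₁, hz₁⟩, -⟩ := h₁
  -- the quadruple (x₁, y, y, z₁) of the target (x₀, z₀)
  have key : ((x₁⁻¹ * y * y⁻¹ * z₁ : GLm p m) : Mat p m) * v x₀ z₀ =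
      ((x₀⁻¹ * z₀ : GLm p m) : Mat p m) * v x₀ z₀ := by
    rw [mul_inv_cancel_right, hv₀]
    exact heq.symm
  obtain ⟨hxx, -, hzz⟩ := hPT x₀ hx₀ z₀ hz₀ x₁ hx₁ y hy y hy z₁ hz₁ key
  rw [hxx, hzz]

end Summit.MatrixMultiplication.MatrixMultiplication.Theorems.LieRankDesigns

end
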